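import Summits.BirchSwinnertonDyer.Rank1Residual.X11a.SelmerCompanionSixKinds
import Summits.BirchSwinnertonDyer.Rank1Residual.X11a.SelmerCompanionFlat
import Summits.BirchSwinnertonDyer.Rank1Residual.X11a.SelmerCompanionSplitStrict
import Literature.NumberTheory.EllipticCurves.LFunctionPrimeCoeff
import HarnessLib

/-!
# Route (3e) SELMER COMPANION, XV: shape D — a partner of ANY rank whose Selmer classes are
# detected at a split level-lowering place of `E` (class X11a = N7; cell `b2b-bsdres`, unit
# `b2b-bsdres-x11a`, gen 28)

HONEST FRAMING (run/shared/lean/b2b/bsd-rank1-residual/, verbatim in every file): the goal of the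
cell is to DELETE the COMBINATION-SHAPED residual classes of the Birch–Swinnerton-Dyer formula for
ALL analytic-rank `≤ 1` elliptic curves over `ℚ` — "full BSD formula for every rank `≤ 1` curve in
class `C`" assembled STRICTLY from published theorems — so that the rank-`≤ 1` remainder becomes
exactly the CONSTRUCTION-SHAPED classes, which are TYPED (missing-input `Prop`s), NOT attempted.
This is not "finishing BSD". CLASS-OWNERS.md: research routes; NO CLAIM BEYOND STATED CLASSES.
THEOREMS ONLY; nothing booked; no label moves. CONDITIONAL on the PUBLISHED binders GZK (`hGZK`),
Cassels–Tate (`hCT`), Tate uniformisation (`hU` = A40, `hU2` = A41), Tate's local Euler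
characteristic (`hEP`, Milne *ADT* I Thm. 2.8), and on the per-pair finite data named.

## What this file proves

The census of gen 28 (`HOME/b2b-bsdres-x11a/g28/SELMER-COMPANION-CENSUS-v4.md`) found that the
N7 cells out of reach of route (3e) at budget `9 = p²` (`p = 3`) are dominated by ONE pattern: the
closed `p`-congruent partner `A` has rank ONE (its Selmer group costs the factor `p`), and `E` has a
SPLIT multiplicative level-lowering place `ℓ₀ ≢ 1 (mod p)` where `A` is good (which costs
`ι_{ℓ₀} = p`, sharply). File XIII removes the first factor whenever NO non-zero class of `Sel^(p)(A)`
satisfies the transported local condition of `E` at `ℓ₀`, and file XIV shows that such a class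
would die in `H¹(ℚ_{ℓ₀}, A[p])`. Hence (`bsdp_of_selmerCompanion_strict_six_kinds`):

**`BSD(E,p)` for a rank-`0` pair `(E,p)` (`p` odd, `E[p]` irreducible, `p ∤ #Ш_an(E)`) from a
`Γ_ℚ`-isomorphism `A[p] ≅ E[p]` with a curve `A` whose `p`-Selmer group INJECTS into
`H¹(ℚ_{ℓ₀}, A[p])` at a split multiplicative place `ℓ₀ ∤ p`, `ℓ₀ ≢ 1 (mod p)`, of `E` where `A` is
good, the places of `S \ T` being of the six kinds of file XII and `∏_{v∈T} #E(ℚ_v)[p]·#(ℤ_v/p) ≤ p`.**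

No hypothesis on `A` beyond the injectivity (`hstrict`) — not even `BSD(A,p)`; in practice it is
certified for a CLOSED rank-one partner (`BSD(A,p)`, `p ∤ #Ш_an(A)`, `A(ℚ)[p] = 0`, so
`Sel^(p)(A) = ⟨κ(P)⟩ ≅ ℤ/p`) by checking that the generator `P` is not `p`-divisible in
`A(ℚ_{ℓ₀})`, i.e. that its reduction is not in `p·Ã(𝔽_{ℓ₀})` — a finite computation on Cremona's
generators. With `T = {ℓ₀}` (cost `#E(ℚ_{ℓ₀})[p] = p`) this is exactly the `21 + 5` budget-`9` cells
of the census at `p = 3` and the cells `115320u1, 184960bn1, 230640bz1` of the non-surjective leaf at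
`p = 5`.

References: files I, XII, XIII, XIV; [MazurRubin2004] §2.3; [SilvermanATAEC1994] V 3.1, 5.3;
[Miller2011LMS] Def. 1.1; HOME/b2b-bsdres-x11a/REPORT-g28.md.
-/

set_option autoImplicit false

noncomputable section

open scoped Classical NNReal

open WeierstrassCurve Literature.NumberTheory.EllipticCurves
  Literature.NumberTheory.GaloisRepresentations Field NumberField IsDedekindDomain
  Literature.NumberTheory.EllipticCurves.Rank1Residual
  Literature.NumberTheory.EllipticCurves.Rank1Residual.Typed

namespace Summit.BirchSwinnertonDyer.Rank1Residual.X11a.SelmerCompanion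

section Rat

variable (W A : WeierstrassCurve ℚ) [W.IsElliptic] [W.IsGloballyMinimal] [A.IsElliptic]
  [A.IsGloballyMinimal] (p : ℕ) [hp : Fact p.Prime]

/-- **The strict count over `ℚ` with six kinds of places.** For `θ : E[p] ≃ A[p]` (`E = W`),
`p` odd, `S`, `T ⊆ S` and the six kinds on `S \ T` as in
`natCard_selmerGroup_le_of_congr_of_six_kinds_rat`, and a place `v₀ = ℓ₀ ∤ p` with `p ∤ ℓ₀ − 1` at
which `E` is SPLIT multiplicative and `A` is GOOD: if every class of `Sel^(p)(A)` restricting to zero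
in `H¹(ℚ_{ℓ₀}, A[p])` is zero (`hstrict`), then `#Sel^(p)(E/ℚ) ≤ ∏_{v ∈ T} #E(ℚ_v)[p] · #(ℤ_v/p)` — no
factor `#Sel^(p)(A)`. (Files XIII + XIV: a class of `Sel^(p)(A) ∩ θ_* 𝓢_{v₀}(E)` dies at `v₀`.)
[cite: MazurRubin2004, §2.3] [cite: SilvermanATAEC1994, Ch. V Thm. 3.1, Lemma 5.2, Thm. 5.3, Cor. 5.4, Ex. 5.11]
[cite: GreenbergLNM1716, §2 Props. 2.2, 2.4] [cite: MilneADT2006, Ch. I §2 Thm. 2.8, Prop. 3.8] -/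
theorem natCard_selmerGroup_le_of_congr_of_six_kinds_strict_rat
    (hU : Silverman1994_thmV53_tateUniformisation.{0})
    (hU2 : Silverman1994_thmV53_corV54_tateUniformisation.{0})
    (hEP : ∀ v : HeightOneSpectrum (𝓞 ℚ), (p : 𝓞 ℚ) ∈ v.asIdeal →
      localEulerPoincareCharacteristic (v.adicCompletion ℚ)) (hp2 : p ≠ 2)
    (θ : geomTorsion W (p : ℤ) ≃+ geomTorsion A (p : ℤ))
    (hθ : ∀ (σ : absoluteGaloisGroup ℚ) (P : geomTorsion W (p : ℤ)), θ (σ • P) = σ • θ P)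
    (S T : Finset (HeightOneSpectrum (𝓞 ℚ))) (hTS : T ⊆ S)
    (hS : ∀ v : HeightOneSpectrum (𝓞 ℚ), v ∉ S →
      A.HasGoodReductionAt v ∧ W.HasGoodReductionAt v ∧ (p : 𝓞 ℚ) ∉ v.asIdeal)
    (hplaces : ∀ v ∈ S, v ∉ T →
      ((p : 𝓞 ℚ) ∉ v.asIdeal ∧ Nat.card (nsmulAddMonoidHom p :
          (W.baseChange (v.adicCompletion ℚ)).toAffine.Point →+ _).ker = 1) ∨
      (A.HasSplitMultiplicativeReductionAt v ∧ W.HasSplitMultiplicativeReductionAt v ∧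
        Nat.card (nsmulAddMonoidHom p :
          (A.baseChange (v.adicCompletion ℚ)).toAffine.Point →+ _).ker ≤ p) ∨
      (A.HasMultiplicativeReductionAt v ∧ W.HasMultiplicativeReductionAt v ∧
        (∃ r : v.adicCompletion ℚ, algebraMap ℚ (v.adicCompletion ℚ) (-(A.c₄ / A.c₆)) =
          r ^ 2 * algebraMap ℚ (v.adicCompletion ℚ) (-(W.c₄ / W.c₆))) ∧
        (∀ ζ : v.adicCompletion ℚ, ζ ^ p = 1 → ζ = 1)) ∨
      (∃ (ℓ : ℕ) (_ : Fact ℓ.Prime), ℓ ≠ 2 ∧ (ℓ : 𝓞 ℚ) ∈ v.asIdeal ∧ (p : 𝓞 ℚ) ∉ v.asIdeal ∧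
        W.HasMultiplicativeReductionAtPrime ℓ ∧
        (∀ r : v.adicCompletion ℚ, algebraMap ℚ (v.adicCompletion ℚ) (-(W.c₄ / W.c₆)) ≠ r ^ 2) ∧
        A.HasGoodReductionAt v) ∨
      ((p : 𝓞 ℚ) ∈ v.asIdeal ∧ W.HasMultiplicativeReductionAtPrime p ∧
        (∀ r : v.adicCompletion ℚ, algebraMap ℚ (v.adicCompletion ℚ) (-(W.c₄ / W.c₆)) ≠ r ^ 2) ∧
        A.HasGoodReductionAtPrime p) ∨
      (∃ (ℓ : ℕ) (_ : Fact ℓ.Prime), ℓ ≠ 2 ∧ (ℓ : 𝓞 ℚ) ∈ v.asIdeal ∧ (p : 𝓞 ℚ) ∉ v.asIdeal ∧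
        W.HasGoodReductionAt v ∧ A.HasMultiplicativeReductionAtPrime ℓ ∧
        (∀ r : v.adicCompletion ℚ, algebraMap ℚ (v.adicCompletion ℚ) (-(A.c₄ / A.c₆)) ≠ r ^ 2)))
    {v₀ : HeightOneSpectrum (𝓞 ℚ)} {ℓ₀ : ℕ} (hℓ₀ : ℓ₀.Prime) (hℓ₀v : (ℓ₀ : 𝓞 ℚ) ∈ v₀.asIdeal)
    (hℓ₀p : ¬ p ∣ ℓ₀ - 1) (hsplit : W.HasSplitMultiplicativeReductionAt v₀)
    (hA₀ : A.HasGoodReductionAt v₀) (hpv₀ : (p : 𝓞 ℚ) ∉ v₀.asIdeal)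
    (hstrict : ∀ d ∈ A.selmerGroup (p : ℤ),
      galoisCohomology.res (A.torsionGaloisModule (p : ℤ)) (v₀.adicCompletion ℚ) 1 d = 0 → d = 0) :
    Nat.card (W.selmerGroup (p : ℤ)) ≤
      ∏ v ∈ T, (Nat.card (nsmulAddMonoidHom p :
          (W.baseChange (v.adicCompletion ℚ)).toAffine.Point →+ _).ker *
        Nat.card (v.adicCompletionIntegers ℚ ⧸ Ideal.span {(p : v.adicCompletionIntegers ℚ)})) := by
  have hpp : p.Prime := hp.out
  classical
  -- `q_{v₀} = ℓ₀`
  have hq : ¬ p ∣ Nat.card (IsLocalRing.ResidueField (v₀.adicCompletionIntegers ℚ)) - 1 := by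
    rw [WeierstrassCurve.natCard_residueField_adicCompletionIntegers v₀,
      Rat.HeightOneSpectrum.primesEquiv_eq_of_natCast_mem v₀ hℓ₀ hℓ₀v]
    exact hℓ₀p
  -- strictness at `v₀` in the form of file XIII
  have hstrict' : ∀ c ∈ selmerLocalKer W (v₀.adicCompletion ℚ) (p : ℤ),
      h1Equiv θ hθ c ∈ A.selmerGroup (p : ℤ) → h1Equiv θ hθ c = 0 := by
    intro c hc hcA
    refine hstrict _ hcA (res_h1Equiv_eq_zero_of_split_of_good W v₀ hU A θ hθ hsplit hA₀ hpv₀ hq hc ?_)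
    exact ((mem_selmerGroup_iff A _ _).mp hcA).1 v₀
  -- enlarge `T` by the places of kind (i)
  set T' := T ∪ S.filter (fun v ↦ (p : 𝓞 ℚ) ∉ v.asIdeal ∧ Nat.card (nsmulAddMonoidHom p :
      (W.baseChange (v.adicCompletion ℚ)).toAffine.Point →+ _).ker = 1) with hT'
  have hT'S : T' ⊆ S := Finset.union_subset hTS (Finset.filter_subset _ _)
  have h1 := natCard_selmerGroup_le_of_congr_of_le_off_strict A W hp2 θ hθ S T' hT'S hS
    (fun v hv hvT c hc ↦ ?_) hstrict'
  · refine h1.trans (le_of_eq ?_)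
    have hsplit' : T' = T ∪ (S.filter (fun v ↦ (p : 𝓞 ℚ) ∉ v.asIdeal ∧ Nat.card (nsmulAddMonoidHom p :
      (W.baseChange (v.adicCompletion ℚ)).toAffine.Point →+ _).ker = 1) \ T) := by
      rw [hT', Finset.union_sdiff_self_eq_union]
    rw [hsplit', Finset.prod_union Finset.disjoint_sdiff,
      Finset.prod_eq_one (s := _ \ T) (fun v hv ↦ ?_), mul_one]
    · refine Finset.prod_congr rfl fun v _ ↦ ?_
      exact W.natCard_kummerLocalConditionAt_adicCompletion v hpp.ne_zero
    · rw [Finset.mem_sdiff, Finset.mem_filter] at hv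
      rw [W.natCard_kummerLocalConditionAt_adicCompletion v hpp.ne_zero, hv.1.2.2, one_mul,
        natCard_quot_adicCompletionIntegers_eq_one hv.1.2.1]
  · have hvT0 : v ∉ T := fun h ↦ hvT (Finset.mem_union_left _ h)
    have hnot1 : ¬ ((p : 𝓞 ℚ) ∉ v.asIdeal ∧ Nat.card (nsmulAddMonoidHom p :
        (W.baseChange (v.adicCompletion ℚ)).toAffine.Point →+ _).ker = 1) := fun h ↦
      hvT (Finset.mem_union_right _ (Finset.mem_filter.mpr ⟨hv, h⟩))
    rcases hplaces v hv hvT0 with h1 | ⟨hWv, hW'v, hcard⟩ | ⟨hWv, hW'v, hγ', hμ⟩ |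
        ⟨ℓ, hℓ, hℓ2, hℓv, hpv, hmult, hγ', hAv⟩ | ⟨hpv, hmult, hγ', hAv⟩ |
        ⟨ℓ, hℓ, hℓ2, hℓv, hpv, hWv, hmultA, hγA⟩
    · exact absurd h1 hnot1
    · exact A.h1Equiv_mem_selmerLocalKer_of_hasSplitMultiplicativeReductionAt v hU W θ hθ hWv hW'v
        hcard hc
    · exact A.h1Equiv_mem_selmerLocalKer_of_hasMultiplicativeReductionAt v hU2 hp2 W θ hθ hWv hW'v
        hγ' hμ hc
    · haveI := hℓ
      exact h1Equiv_mem_selmerLocalKer_of_nonsplit_of_good_rat W A p hU2 hp2 θ hθ hℓ2 hℓv hmult hγ'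
        hAv hpv hc
    · exact h1Equiv_mem_selmerLocalKer_of_nonsplit_of_good_at_p W A p hU2 hp2 θ hθ hpv (hEP v hpv)
        hmult hγ' hAv hc
    · haveI := hℓ
      exact h1Equiv_mem_selmerLocalKer_of_good_of_nonsplit_rat W A p hU2 hp2 θ hθ hℓ2 hℓv hWv hmultA
        hγA hpv hc

/-- **Shape D of route (3e) over `ℚ` — a partner of any rank, strict at a split level-lowering
place.** Let `p` be an odd prime, `E = W` globally minimal of analytic rank `0` with `E[p]`
irreducible and `p ∤ #Ш_an(E)`; `A` globally minimal with a `Γ_ℚ`-isomorphism `e : A[p] ≅ E[p]`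
(certificate C1); `S ⊇ T` finite sets of places as in file XII with the six kinds on `S \ T`; and a
place `ℓ₀ ∤ p`, `p ∤ ℓ₀ − 1`, at which `E` is SPLIT multiplicative and `A` is GOOD, such that
`Sel^(p)(A/ℚ) → H¹(ℚ_{ℓ₀}, A[p])` is injective (`hstrict`; for a closed rank-one partner: the
generator of `A(ℚ)` is not `p`-divisible in `A(ℚ_{ℓ₀})`). If `∏_{v∈T} #E(ℚ_v)[p]·#(ℤ_v/p) ≤ p` then
`BSD(E,p)`: the strict count gives `#Sel^(p)(E/ℚ) ≤ p`, Cassels–Tate parity gives `Sel^(p)(E) = 0`,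
so `Ш(E)[p] = 0` (`bsdp_of_natCard_selmerGroup_le`). NO hypothesis `BSD(A,p)`, no rank condition on
`A`. Binders GZK, Cassels–Tate, A40/A41, Milne I.2.8. Not a class theorem; nothing booked.
[cite: MazurRubin2004, §2.3] [cite: Miller2011LMS, §1 and Def. 1.1]
[cite: SilvermanATAEC1994, Ch. V Thm. 3.1, Lemma 5.2, Thm. 5.3, Cor. 5.4, Ex. 5.11]
[cite: GreenbergLNM1716, §2 Props. 2.2, 2.4] [cite: MilneADT2006, Ch. I §2 Thm. 2.8, Prop. 3.8] -/
theorem bsdp_of_selmerCompanion_strict_six_kinds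
    (hU : Silverman1994_thmV53_tateUniformisation.{0})
    (hU2 : Silverman1994_thmV53_corV54_tateUniformisation.{0})
    (hEP : ∀ v : HeightOneSpectrum (𝓞 ℚ), (p : 𝓞 ℚ) ∈ v.asIdeal →
      localEulerPoincareCharacteristic (v.adicCompletion ℚ))
    (hGZK : rank_eq_analyticRank_of_analyticRank_le_one)
    (hCT : exists_casselsTate_pairing (K := ℚ)) (hp2 : p ≠ 2)
    (hr : W.analyticRank = 0) (hirr : Irr W p) (hSha : X11a.ShaAnUnit W p)
    (e : geomTorsion A (p : ℤ) ≃+ geomTorsion W (p : ℤ))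
    (he : ∀ (σ : absoluteGaloisGroup ℚ) (P : geomTorsion A (p : ℤ)), e (σ • P) = σ • e P)
    (S T : Finset (HeightOneSpectrum (𝓞 ℚ))) (hTS : T ⊆ S)
    (hS : ∀ v : HeightOneSpectrum (𝓞 ℚ), v ∉ S →
      A.HasGoodReductionAt v ∧ W.HasGoodReductionAt v ∧ (p : 𝓞 ℚ) ∉ v.asIdeal)
    (hplaces : ∀ v ∈ S, v ∉ T →
      ((p : 𝓞 ℚ) ∉ v.asIdeal ∧ Nat.card (nsmulAddMonoidHom p :
          (W.baseChange (v.adicCompletion ℚ)).toAffine.Point →+ _).ker = 1) ∨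
      (A.HasSplitMultiplicativeReductionAt v ∧ W.HasSplitMultiplicativeReductionAt v ∧
        Nat.card (nsmulAddMonoidHom p :
          (A.baseChange (v.adicCompletion ℚ)).toAffine.Point →+ _).ker ≤ p) ∨
      (A.HasMultiplicativeReductionAt v ∧ W.HasMultiplicativeReductionAt v ∧
        (∃ r : v.adicCompletion ℚ, algebraMap ℚ (v.adicCompletion ℚ) (-(A.c₄ / A.c₆)) =
          r ^ 2 * algebraMap ℚ (v.adicCompletion ℚ) (-(W.c₄ / W.c₆))) ∧
        (∀ ζ : v.adicCompletion ℚ, ζ ^ p = 1 → ζ = 1)) ∨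
      (∃ (ℓ : ℕ) (_ : Fact ℓ.Prime), ℓ ≠ 2 ∧ (ℓ : 𝓞 ℚ) ∈ v.asIdeal ∧ (p : 𝓞 ℚ) ∉ v.asIdeal ∧
        W.HasMultiplicativeReductionAtPrime ℓ ∧
        (∀ r : v.adicCompletion ℚ, algebraMap ℚ (v.adicCompletion ℚ) (-(W.c₄ / W.c₆)) ≠ r ^ 2) ∧
        A.HasGoodReductionAt v) ∨
      ((p : 𝓞 ℚ) ∈ v.asIdeal ∧ W.HasMultiplicativeReductionAtPrime p ∧
        (∀ r : v.adicCompletion ℚ, algebraMap ℚ (v.adicCompletion ℚ) (-(W.c₄ / W.c₆)) ≠ r ^ 2) ∧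
        A.HasGoodReductionAtPrime p) ∨
      (∃ (ℓ : ℕ) (_ : Fact ℓ.Prime), ℓ ≠ 2 ∧ (ℓ : 𝓞 ℚ) ∈ v.asIdeal ∧ (p : 𝓞 ℚ) ∉ v.asIdeal ∧
        W.HasGoodReductionAt v ∧ A.HasMultiplicativeReductionAtPrime ℓ ∧
        (∀ r : v.adicCompletion ℚ, algebraMap ℚ (v.adicCompletion ℚ) (-(A.c₄ / A.c₆)) ≠ r ^ 2)))
    {v₀ : HeightOneSpectrum (𝓞 ℚ)} {ℓ₀ : ℕ} (hℓ₀ : ℓ₀.Prime) (hℓ₀v : (ℓ₀ : 𝓞 ℚ) ∈ v₀.asIdeal)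
    (hℓ₀p : ¬ p ∣ ℓ₀ - 1) (hsplit : W.HasSplitMultiplicativeReductionAt v₀)
    (hA₀ : A.HasGoodReductionAt v₀) (hpv₀ : (p : 𝓞 ℚ) ∉ v₀.asIdeal)
    (hstrict : ∀ d ∈ A.selmerGroup (p : ℤ),
      galoisCohomology.res (A.torsionGaloisModule (p : ℤ)) (v₀.adicCompletion ℚ) 1 d = 0 → d = 0)
    (hbudget : ∏ v ∈ T, (Nat.card (nsmulAddMonoidHom p :
        (W.baseChange (v.adicCompletion ℚ)).toAffine.Point →+ _).ker *
          Nat.card (v.adicCompletionIntegers ℚ ⧸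
            Ideal.span {(p : v.adicCompletionIntegers ℚ)})) ≤ p) :
    BSDp W p := by
  have hθ : ∀ (σ : absoluteGaloisGroup ℚ) (Q : geomTorsion W (p : ℤ)),
      e.symm (σ • Q) = σ • e.symm Q := fun σ Q ↦ by
    apply e.injective
    rw [e.apply_symm_apply, he, e.apply_symm_apply]
  have hle := natCard_selmerGroup_le_of_congr_of_six_kinds_strict_rat W A p hU hU2 hEP hp2 e.symm hθ
    S T hTS hS hplaces hℓ₀ hℓ₀v hℓ₀p hsplit hA₀ hpv₀ hstrict
  exact bsdp_of_natCard_selmerGroup_le W p hGZK hCT hr hirr hSha (hle.trans hbudget)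

end Rat

end Summit.BirchSwinnertonDyer.Rank1Residual.X11a.SelmerCompanion

end
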